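import Literature.NumberTheory.BeurlingPrimes.LogPowerSeries
import Literature.NumberTheory.BeurlingPrimes.LiAbel
import Literature.NumberTheory.BeurlingPrimes.DMVLogRatioMellin
import Literature.NumberTheory.BeurlingPrimes.PowerProductCount
import Mathlib.NumberTheory.ZetaValues
import Mathlib.Analysis.Real.Pi.Bounds
import HarnessLib

/-!
# The template `li` of Broucke–Vindas: `li(x) = Σ_{n≥1} (log x)ⁿ/(n·n!·ζ(n+1))`, `Σ_ν li(x^{1/ν})/ν = Li(x)`

Topic `Literature/NumberTheory/BeurlingPrimes`. Everything in this file is PROVED (definitions + theorems).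

Broucke–Vindas (2024), proof of Theorem 3.1: "We apply Theorem 1.2 to `F(x) = li(x)`, where `li` is such that
`Li(x) = Σ_{ν≥1} li(x^{1/ν})/ν`. A small computation shows that
`li(x) = Σ_{ν=1}^∞ (μ(ν)/ν) Li(x^{1/ν}) = Σ_{n=1}^∞ (log x)ⁿ/(n! n ζ(n+1))`. … The Chebyshev bound holds since
`li(x) ≤ Σ_{n=1}^∞ (log x)ⁿ/(n! n) = Li(x) ≤ 2x/log x`" (also BDR 2023, (2.1)–(2.2)). With the tree's
`logSeries c L = Σ c n Lⁿ/n!` (`LogPowerSeries.lean`) and `Li(x) = ∫₁ˣ (1 − u⁻¹)/log u du`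
(`WellBehavedSystems.lean`), this file provides:

* `zetaN k = Σ_{m≥1} m^{−k}` (`= ζ(k)`, `k ≥ 2`) with `1 ≤ ζ(k)`, `ζ(2) = π²/6`, `ζ(k) − 1 ≤ 2^{−(k−2)}`;
* the coefficients `LiCoeff n = 1/n`, `liCoeff n = 1/(n ζ(n+1))` (`n ≥ 1`) and
  **`li x = logSeries liCoeff (log (max x 1))`** (so `li = 0` on `(−∞, 1]`): non-negative, monotone,
  continuous, `→ ∞`, with derivative `liDens x = x⁻¹ Σ_{n≥0} liCoeff (n+1) (log x)ⁿ/n!` on `(1, ∞)`;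
* BDR (2.1) `Li(x) = Σ_{n≥1} (log x)ⁿ/(n·n!)` (`Li_eq_logSeries`, by comparing derivatives), `li ≤ Li`,
  BV's Chebyshev bound `Li(x) ≤ 2x/log x` (`Li_le`), and `Li(y) ≤ y − 1`;
* the density comparison used for the Mellin transforms: with `poleDensity u = (1 − 1/u)/log u = Li′(u)`
  (tree, `DMVLogRatioMellin.lean`), `0 ≤ liDens u ≤ poleDensity u ≤ 1` and
  `poleDensity u − liDens u ≤ u^{−1/2}` for `u > 1` (coefficientwise `1 − 1/ζ(n+2) ≤ 2^{−n}`, and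
  `Σ (log u/2)ⁿ/n! = √u`);
* **`Σ_{k≥1} li(x^{1/k})/k = Li(x)`** (`hasSum_li_rpow_div`, the defining property of `li`, by Fubini for the
  non-negative double series `Σ_{n,k} liCoeff n (log x)ⁿ k^{−(n+1)}/n!` and `liCoeff n · ζ(n+1) = 1/n`).

## References
* [BrouckeVindas2024] F. Broucke, J. Vindas, *A new generalized prime random approximation procedure and some of
  its applications*, Math. Z. 307 (2024), arXiv:2102.08478, proof of Theorem 3.1 (read).
* [BrouckeDebruyneRevesz2023] F. Broucke, G. Debruyne, Sz. Gy. Révész, *Some examples of well-behaved Beurling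
  number systems*, arXiv:2309.01567, §2 (2.1)–(2.2) (read).
-/

noncomputable section

open Filter Set Real
open scoped Topology Nat

namespace Literature.NumberTheory.BeurlingPrimes

/-! ### `ζ(k)` for integers `k ≥ 2` as a real series -/

/-- `zetaN k = Σ_{m ≥ 1} m^{−k}` (the Riemann zeta value `ζ(k)` for `k ≥ 2`, as a real series).
[cite: BrouckeVindas2024, proof of Theorem 3.1] -/
def zetaN (k : ℕ) : ℝ := ∑' m : ℕ, 1 / ((m + 1 : ℕ) : ℝ) ^ k

/-- The defining series of `zetaN k` converges for `k ≥ 2`. [folklore] -/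
theorem summable_one_div_succ_pow {k : ℕ} (hk : 2 ≤ k) : Summable fun m : ℕ ↦ 1 / ((m + 1 : ℕ) : ℝ) ^ k :=
  (summable_nat_add_iff 1).mpr (Real.summable_one_div_nat_pow.mpr (by omega))

/-- `1 ≤ ζ(k)` (`k ≥ 2`): the first term. [folklore] -/
theorem one_le_zetaN {k : ℕ} (hk : 2 ≤ k) : 1 ≤ zetaN k := by
  have h := (summable_one_div_succ_pow hk).le_tsum 0 (fun m _ ↦ by positivity)
  simpa [zetaN] using h

/-- `0 < ζ(k)` (`k ≥ 2`). [folklore] -/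
theorem zetaN_pos {k : ℕ} (hk : 2 ≤ k) : 0 < zetaN k := lt_of_lt_of_le one_pos (one_le_zetaN hk)

/-- `zetaN k` is the value at `s = k` of the tree's real series `zetaR s = Σ_{m ≥ 0} m^{−s}`
(`PowerProductCount.lean`; the `m = 0` term vanishes). [folklore] -/
theorem zetaN_eq_zetaR {k : ℕ} (hk : 2 ≤ k) : zetaN k = zetaR (k : ℝ) := by
  have hs : (1 : ℝ) < (k : ℝ) := by exact_mod_cast (show 1 < k by omega)
  rw [zetaR, (summable_rpow_neg hs).tsum_eq_zero_add]
  have hk0 : (k : ℝ) ≠ 0 := by exact_mod_cast (show k ≠ 0 by omega)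
  have h0 : ((0 : ℕ) : ℝ) ^ (-(k : ℝ)) = 0 := by
    rw [Nat.cast_zero, Real.zero_rpow (neg_ne_zero.mpr hk0)]
  rw [h0, zero_add, zetaN]
  refine tsum_congr fun m ↦ ?_
  rw [Real.rpow_neg (Nat.cast_nonneg _), Real.rpow_natCast, one_div]

/-- `ζ(2) = π²/6` (Mathlib's `hasSum_zeta_two`). [folklore] -/
theorem zetaN_two : zetaN 2 = π ^ 2 / 6 := by
  have h := (hasSum_nat_add_iff' 1).mpr hasSum_zeta_two
  simp only [Finset.range_one, Finset.sum_singleton, Nat.cast_zero, ne_eq, OfNat.ofNat_ne_zero,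
    not_false_eq_true, zero_pow, div_zero, sub_zero] at h
  rw [zetaN, ← h.tsum_eq]

/-- `ζ(2) ≤ 2` (`π² ≤ 12`). [folklore] -/
theorem zetaN_two_le_two : zetaN 2 ≤ 2 := by
  rw [zetaN_two]
  have h := Real.pi_lt_d2
  have h0 := Real.pi_pos
  nlinarith

/-- `ζ(k) − 1 ≤ 2^{−(k−2)} (ζ(2) − 1) ≤ 2^{−(k−2)}` for `k ≥ 2` (`m^{−k} ≤ 2^{−(k−2)} m^{−2}` for `m ≥ 2`).
[folklore] -/
theorem zetaN_sub_one_le {k : ℕ} (hk : 2 ≤ k) : zetaN k - 1 ≤ (1 / 2 : ℝ) ^ (k - 2) := by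
  have hs := summable_one_div_succ_pow hk
  have hs2 := summable_one_div_succ_pow (le_refl 2)
  -- split off the first term of both series
  have hk' : zetaN k = 1 + ∑' m : ℕ, 1 / ((m + 1 + 1 : ℕ) : ℝ) ^ k := by
    rw [zetaN, hs.tsum_eq_zero_add]; simp
  have h2' : zetaN 2 = 1 + ∑' m : ℕ, 1 / ((m + 1 + 1 : ℕ) : ℝ) ^ 2 := by
    rw [zetaN, hs2.tsum_eq_zero_add]; simp
  have htail : Summable fun m : ℕ ↦ 1 / ((m + 1 + 1 : ℕ) : ℝ) ^ k := (summable_nat_add_iff 1).mpr hs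
  have htail2 : Summable fun m : ℕ ↦ 1 / ((m + 1 + 1 : ℕ) : ℝ) ^ 2 := (summable_nat_add_iff 1).mpr hs2
  have hterm : ∀ m : ℕ, 1 / ((m + 1 + 1 : ℕ) : ℝ) ^ k ≤ (1 / 2 : ℝ) ^ (k - 2) * (1 / ((m + 1 + 1 : ℕ) : ℝ) ^ 2) := by
    intro m
    have hm2 : (2 : ℝ) ≤ ((m + 1 + 1 : ℕ) : ℝ) := by push_cast; linarith [(Nat.cast_nonneg m : (0:ℝ) ≤ m)]
    have hm0 : (0 : ℝ) < ((m + 1 + 1 : ℕ) : ℝ) := by positivity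
    obtain ⟨j, rfl⟩ : ∃ j, k = j + 2 := ⟨k - 2, by omega⟩
    simp only [Nat.add_sub_cancel]
    rw [pow_add, one_div, mul_inv, one_div, one_div]
    refine mul_le_mul_of_nonneg_right ?_ (by positivity)
    rw [← inv_pow]
    exact pow_le_pow_left₀ (by positivity) ((inv_le_inv₀ hm0 two_pos).mpr hm2) j
  have hsum_le : ∑' m : ℕ, 1 / ((m + 1 + 1 : ℕ) : ℝ) ^ k ≤ (1 / 2 : ℝ) ^ (k - 2) * ∑' m : ℕ, 1 / ((m + 1 + 1 : ℕ) : ℝ) ^ 2 := by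
    rw [← tsum_mul_left]
    exact htail.tsum_le_tsum hterm (htail2.mul_left _)
  have h22 : ∑' m : ℕ, 1 / ((m + 1 + 1 : ℕ) : ℝ) ^ 2 ≤ 1 := by linarith [zetaN_two_le_two]
  calc zetaN k - 1 = ∑' m : ℕ, 1 / ((m + 1 + 1 : ℕ) : ℝ) ^ k := by rw [hk']; ring
    _ ≤ (1 / 2 : ℝ) ^ (k - 2) * ∑' m : ℕ, 1 / ((m + 1 + 1 : ℕ) : ℝ) ^ 2 := hsum_le
    _ ≤ (1 / 2 : ℝ) ^ (k - 2) * 1 := mul_le_mul_of_nonneg_left h22 (by positivity)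
    _ = (1 / 2 : ℝ) ^ (k - 2) := mul_one _

/-- `1 − 1/ζ(n+2) ≤ 2^{−n}`. [folklore] -/
theorem one_sub_inv_zetaN_le (n : ℕ) : 1 - (zetaN (n + 2))⁻¹ ≤ (1 / 2 : ℝ) ^ n := by
  have hz := one_le_zetaN (by omega : 2 ≤ n + 2)
  have hz0 : 0 < zetaN (n + 2) := by linarith
  have h1 : 1 - (zetaN (n + 2))⁻¹ ≤ zetaN (n + 2) - 1 := by
    rw [show 1 - (zetaN (n + 2))⁻¹ = (zetaN (n + 2) - 1) / zetaN (n + 2) by field_simp]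
    exact div_le_self (by linarith) hz
  have h2 := zetaN_sub_one_le (by omega : 2 ≤ n + 2)
  simp only [Nat.add_sub_cancel] at h2
  linarith

/-! ### The coefficients of `Li` and `li` -/

/-- The coefficients of `Li`: `LiCoeff n = 1/n` (`n ≥ 1`), `LiCoeff 0 = 0`, so that
`logSeries LiCoeff (log x) = Σ_{n≥1} (log x)ⁿ/(n·n!)`. [cite: BrouckeDebruyneRevesz2023, §2 (2.1)] -/
def LiCoeff (n : ℕ) : ℝ := if n = 0 then 0 else 1 / n

/-- The coefficients of `li`: `liCoeff n = 1/(n ζ(n+1))` (`n ≥ 1`), `liCoeff 0 = 0`.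
[cite: BrouckeVindas2024, proof of Theorem 3.1] -/
def liCoeff (n : ℕ) : ℝ := if n = 0 then 0 else 1 / (n * zetaN (n + 1))

/-- `LiCoeff n ≥ 0`. [folklore] -/
theorem LiCoeff_nonneg (n : ℕ) : 0 ≤ LiCoeff n := by
  unfold LiCoeff; split_ifs <;> positivity

/-- `LiCoeff n ≤ 1`. [folklore] -/
theorem LiCoeff_le_one (n : ℕ) : LiCoeff n ≤ 1 := by
  unfold LiCoeff
  split_ifs with h
  · exact zero_le_one
  · exact div_le_self zero_le_one (by exact_mod_cast Nat.one_le_iff_ne_zero.mpr h)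

/-- `liCoeff n ≥ 0`. [folklore] -/
theorem liCoeff_nonneg (n : ℕ) : 0 ≤ liCoeff n := by
  unfold liCoeff
  split_ifs with h
  · exact le_rfl
  · have := zetaN_pos (by omega : 2 ≤ n + 1)
    positivity

/-- `liCoeff n ≤ LiCoeff n` (`ζ(n+1) ≥ 1`). [cite: BrouckeVindas2024, proof of Theorem 3.1] -/
theorem liCoeff_le_LiCoeff (n : ℕ) : liCoeff n ≤ LiCoeff n := by
  unfold liCoeff LiCoeff
  split_ifs with h
  · exact le_rfl
  · have hz := one_le_zetaN (by omega : 2 ≤ n + 1)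
    have hn : (0 : ℝ) < n := by exact_mod_cast Nat.pos_of_ne_zero h
    rw [one_div_le_one_div (by positivity) hn]
    nlinarith

/-- The geometric bound for `LiCoeff` (`A = R = 1`). [folklore] -/
theorem abs_LiCoeff_le (n : ℕ) : |LiCoeff n| ≤ 1 * 1 ^ n := by
  rw [abs_of_nonneg (LiCoeff_nonneg n), one_mul, one_pow]; exact LiCoeff_le_one n

/-- The geometric bound for `liCoeff` (`A = R = 1`). [folklore] -/
theorem abs_liCoeff_le (n : ℕ) : |liCoeff n| ≤ 1 * 1 ^ n := by
  rw [abs_of_nonneg (liCoeff_nonneg n), one_mul, one_pow]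
  exact (liCoeff_le_LiCoeff n).trans (LiCoeff_le_one n)

/-- `liCoeff n · ζ(n+1) = LiCoeff n`. [cite: BrouckeVindas2024, proof of Theorem 3.1] -/
theorem liCoeff_mul_zetaN (n : ℕ) : liCoeff n * zetaN (n + 1) = LiCoeff n := by
  unfold liCoeff LiCoeff
  split_ifs with h
  · simp
  · have hz := zetaN_pos (by omega : 2 ≤ n + 1)
    have hn : (0 : ℝ) < n := by exact_mod_cast Nat.pos_of_ne_zero h
    field_simp

/-- The shifted `Li` coefficients are `1^{n+1}/(n+1)`. [folklore] -/
theorem LiCoeff_succ_eq : (fun n : ℕ ↦ LiCoeff (n + 1)) = fun n : ℕ ↦ (1 : ℝ) ^ (n + 1) / (n + 1) := by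
  funext n
  simp [LiCoeff]

/-- **`L · Σ_{n≥0} LiCoeff (n+1) Lⁿ/n! = e^L − 1`** (`= x − 1` at `L = log x`).
[cite: BrouckeDebruyneRevesz2023, §2 (2.5)] -/
theorem mul_logSeries_LiCoeff_succ (L : ℝ) :
    L * logSeries (fun n ↦ LiCoeff (n + 1)) L = Real.exp L - 1 := by
  rw [LiCoeff_succ_eq, mul_logSeries_pow_succ_div, one_mul]

/-! ### `li` -/

/-- **Broucke–Vindas's `li`**: `li x = Σ_{n≥1} (log x)ⁿ/(n·n!·ζ(n+1))` for `x ≥ 1`, extended by `0` on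
`(−∞, 1]` (implemented as `logSeries liCoeff (log (max x 1))`). [cite: BrouckeVindas2024, proof of Theorem 3.1] -/
def li (x : ℝ) : ℝ := logSeries liCoeff (Real.log (max x 1))

/-- On `[1, ∞)`, `li x = logSeries liCoeff (log x)`. [cite: BrouckeVindas2024, proof of Theorem 3.1] -/
theorem li_eq_of_one_le {x : ℝ} (hx : 1 ≤ x) : li x = logSeries liCoeff (Real.log x) := by
  rw [li, max_eq_left hx]

/-- `li x = 0` for `x ≤ 1`. [cite: BrouckeVindas2024, proof of Theorem 3.1] -/
theorem li_eq_zero_of_le_one {x : ℝ} (hx : x ≤ 1) : li x = 0 := by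
  rw [li, max_eq_right hx, Real.log_one, logSeries_zero]
  simp [liCoeff]

/-- `li 1 = 0`. [cite: BrouckeVindas2024, proof of Theorem 3.1] -/
@[simp] theorem li_one : li 1 = 0 := li_eq_zero_of_le_one le_rfl

/-- `li ≥ 0`. [cite: BrouckeVindas2024, proof of Theorem 3.1] -/
theorem li_nonneg (x : ℝ) : 0 ≤ li x :=
  logSeries_nonneg liCoeff_nonneg (Real.log_nonneg (le_max_right x 1))

/-- `li` is non-decreasing. [cite: BrouckeVindas2024, proof of Theorem 3.1] -/
theorem li_mono : Monotone li := fun x _ hxy ↦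
  logSeries_mono zero_le_one abs_liCoeff_le liCoeff_nonneg (Real.log_nonneg (le_max_right x 1))
    (Real.log_le_log (lt_of_lt_of_le one_pos (le_max_right x 1)) (max_le_max hxy le_rfl))

/-- `li` is continuous. [cite: BrouckeVindas2024, proof of Theorem 3.1] -/
theorem continuous_li : Continuous li :=
  (continuous_logSeries zero_le_one abs_liCoeff_le).comp
    ((continuous_id.max continuous_const).log fun x ↦ ne_of_gt (lt_of_lt_of_le one_pos (le_max_right x 1)))

/-- `li x ≥ log x/ζ(2)` (the first term) for `x ≥ 1`. [cite: BrouckeVindas2024, proof of Theorem 3.1] -/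
theorem log_div_le_li {x : ℝ} (hx : 1 ≤ x) : Real.log x / zetaN 2 ≤ li x := by
  have h := term_le_logSeries zero_le_one abs_liCoeff_le liCoeff_nonneg (Real.log_nonneg hx) 1
  rw [li_eq_of_one_le hx]
  refine le_trans (le_of_eq ?_) h
  simp [liCoeff]
  ring

/-- `li x → ∞`. [cite: BrouckeVindas2024, proof of Theorem 3.1] -/
theorem tendsto_li_atTop : Tendsto li atTop atTop := by
  have hz := zetaN_pos (le_refl 2)
  have h : Tendsto (fun x ↦ Real.log x / zetaN 2) atTop atTop := Real.tendsto_log_atTop.atTop_div_const hz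
  refine tendsto_atTop_mono' atTop ?_ h
  filter_upwards [eventually_ge_atTop (1 : ℝ)] with x hx using log_div_le_li hx

/-! ### The derivative `liDens` of `li` -/

/-- The density `li′(u) = u⁻¹ Σ_{n≥0} liCoeff (n+1) (log u)ⁿ/n!` for `u > 1`, and `0` for `u ≤ 1`.
[cite: BrouckeVindas2024, proof of Theorem 3.1] -/
def liDens (u : ℝ) : ℝ := if 1 < u then logSeries (fun n ↦ liCoeff (n + 1)) (Real.log u) * u⁻¹ else 0

/-- `liDens u = 0` for `u ≤ 1`. [cite: BrouckeVindas2024, proof of Theorem 3.1] -/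
theorem liDens_of_le_one {u : ℝ} (hu : u ≤ 1) : liDens u = 0 := by
  rw [liDens, if_neg (not_lt.mpr hu)]

/-- `liDens u` for `u > 1`. [cite: BrouckeVindas2024, proof of Theorem 3.1] -/
theorem liDens_of_one_lt {u : ℝ} (hu : 1 < u) :
    liDens u = logSeries (fun n ↦ liCoeff (n + 1)) (Real.log u) * u⁻¹ := by
  rw [liDens, if_pos hu]

/-- The geometric bound for the shifted coefficients. [folklore] -/
theorem abs_liCoeff_succ_le (n : ℕ) : |liCoeff (n + 1)| ≤ 1 * 1 ^ n := by
  have := abs_liCoeff_le (n + 1); simpa using this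

/-- The geometric bound for the shifted coefficients. [folklore] -/
theorem abs_LiCoeff_succ_le (n : ℕ) : |LiCoeff (n + 1)| ≤ 1 * 1 ^ n := by
  have := abs_LiCoeff_le (n + 1); simpa using this

/-- **`li′ = liDens` on `(1, ∞)`** (termwise differentiation of the log-power series).
[cite: BrouckeVindas2024, proof of Theorem 3.1] -/
theorem hasDerivAt_li {x : ℝ} (hx : 1 < x) : HasDerivAt li (liDens x) x := by
  have h := hasDerivAt_logSeries_log (c := liCoeff) zero_le_one abs_liCoeff_le (ne_of_gt (lt_trans one_pos hx))
  have heq : li =ᶠ[𝓝 x] fun y ↦ logSeries liCoeff (Real.log y) := by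
    filter_upwards [Ioi_mem_nhds hx] with y hy using li_eq_of_one_le (le_of_lt hy)
  rw [liDens_of_one_lt hx]
  exact h.congr_of_eventuallyEq heq

/-- `liDens` is measurable. [folklore] -/
theorem measurable_liDens : Measurable liDens := by
  have h1 : Measurable fun u : ℝ ↦ logSeries (fun n ↦ liCoeff (n + 1)) (Real.log u) * u⁻¹ :=
    ((continuous_logSeries zero_le_one abs_liCoeff_succ_le).measurable.comp Real.measurable_log).mul
      measurable_inv
  exact Measurable.ite measurableSet_Ioi h1 measurable_const

/-- `liDens ≥ 0`. [cite: BrouckeVindas2024, proof of Theorem 3.1] -/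
theorem liDens_nonneg (u : ℝ) : 0 ≤ liDens u := by
  by_cases hu : 1 < u
  · rw [liDens_of_one_lt hu]
    exact mul_nonneg (logSeries_nonneg (fun n ↦ liCoeff_nonneg _) (Real.log_nonneg hu.le))
      (inv_nonneg.mpr (by linarith))
  · rw [liDens, if_neg hu]

/-! ### Comparison with `poleDensity = Li′` -/

/-- `poleDensity u = u⁻¹ Σ_{n≥0} LiCoeff (n+1) (log u)ⁿ/n!` for `u > 1` (`= (1 − 1/u)/log u`).
[cite: BrouckeDebruyneRevesz2023, §2 (2.5)] -/
theorem poleDensity_eq_logSeries {u : ℝ} (hu : 1 < u) :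
    DMV.poleDensity u = logSeries (fun n ↦ LiCoeff (n + 1)) (Real.log u) * u⁻¹ := by
  have hL : 0 < Real.log u := Real.log_pos hu
  have hu0 : 0 < u := lt_trans one_pos hu
  have h := mul_logSeries_LiCoeff_succ (Real.log u)
  rw [Real.exp_log hu0] at h
  unfold DMV.poleDensity
  field_simp
  field_simp at h
  linarith

/-- **`liDens ≤ poleDensity`** on `(1, ∞)` (coefficientwise `liCoeff ≤ LiCoeff`): `d li ≤ dLi`.
[cite: BrouckeVindas2024, proof of Theorem 3.1] -/
theorem liDens_le_poleDensity {u : ℝ} (hu : 1 < u) : liDens u ≤ DMV.poleDensity u := by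
  rw [liDens_of_one_lt hu, poleDensity_eq_logSeries hu]
  refine mul_le_mul_of_nonneg_right ?_ (inv_nonneg.mpr (by linarith))
  exact logSeries_le_logSeries zero_le_one abs_liCoeff_succ_le zero_le_one abs_LiCoeff_succ_le
    (fun n ↦ liCoeff_le_LiCoeff _) (Real.log_nonneg hu.le)

/-- `poleDensity u ≤ 1` for `u > 1` (`1 − u⁻¹ ≤ log u`). [folklore] -/
theorem poleDensity_le_one {u : ℝ} (hu : 1 < u) : DMV.poleDensity u ≤ 1 := by
  have h := Li_integrand_le_one hu
  unfold DMV.poleDensity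
  rwa [one_div]

/-- `|liDens u| ≤ 2` on `(1, ∞)` (indeed `0 ≤ liDens ≤ 1`). [cite: BrouckeVindas2024, proof of Theorem 3.1] -/
theorem abs_liDens_le_two (u : ℝ) (hu : 1 < u) : |liDens u| ≤ 2 := by
  rw [abs_of_nonneg (liDens_nonneg u)]
  linarith [liDens_le_poleDensity hu, poleDensity_le_one hu]

/-- **`0 ≤ poleDensity u − liDens u ≤ u^{−1/2}`** for `u > 1`: coefficientwise
`LiCoeff(n+1) − liCoeff(n+1) = (1 − 1/ζ(n+2))/(n+1) ≤ 2^{−n}` and `Σ (log u/2)ⁿ/n! = √u`.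
[cite: BrouckeVindas2024, proof of Theorem 3.1] -/
theorem poleDensity_sub_liDens {u : ℝ} (hu : 1 < u) :
    0 ≤ DMV.poleDensity u - liDens u ∧ DMV.poleDensity u - liDens u ≤ 1 * u ^ (-(1 / 2 : ℝ)) := by
  refine ⟨by linarith [liDens_le_poleDensity hu], ?_⟩
  have hu0 : 0 < u := lt_trans one_pos hu
  have hL : 0 ≤ Real.log u := Real.log_nonneg hu.le
  set d : ℕ → ℝ := fun n ↦ LiCoeff (n + 1) - liCoeff (n + 1) with hd
  have hd0 : ∀ n, 0 ≤ d n := fun n ↦ by simp only [hd]; linarith [liCoeff_le_LiCoeff (n + 1)]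
  have hdle : ∀ n, d n ≤ (1 / 2 : ℝ) ^ n := by
    intro n
    have hz := zetaN_pos (by omega : 2 ≤ n + 1 + 1)
    have h1 : d n = (1 - (zetaN (n + 2))⁻¹) / (n + 1) := by
      simp only [hd, LiCoeff, liCoeff, Nat.succ_ne_zero, if_false]
      push_cast
      field_simp
    rw [h1]
    have h2 := one_sub_inv_zetaN_le n
    have h3 : 0 ≤ 1 - (zetaN (n + 2))⁻¹ := by
      rw [sub_nonneg]; exact inv_le_one_of_one_le₀ (one_le_zetaN (by omega))
    exact (div_le_self h3 (by linarith [(Nat.cast_nonneg n : (0:ℝ) ≤ n)])).trans h2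
  have hdabs : ∀ n, |d n| ≤ 1 * 1 ^ n := fun n ↦ by
    rw [abs_of_nonneg (hd0 n), one_mul, one_pow]
    exact (hdle n).trans (pow_le_one₀ (by norm_num) (by norm_num))
  have hhalf : ∀ n, |(1 / 2 : ℝ) ^ n| ≤ 1 * (1 / 2) ^ n := fun n ↦ by
    rw [abs_of_nonneg (by positivity), one_mul]
  -- `poleDensity − liDens = u⁻¹ · logSeries d (log u)`
  have hdiff : DMV.poleDensity u - liDens u = logSeries d (Real.log u) * u⁻¹ := by
    rw [poleDensity_eq_logSeries hu, liDens_of_one_lt hu, ← sub_mul]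
    congr 1
    have hadd := logSeries_add zero_le_one hdabs zero_le_one abs_liCoeff_succ_le (Real.log u)
    have : (fun n ↦ d n + liCoeff (n + 1)) = fun n ↦ LiCoeff (n + 1) := by
      funext n; simp only [hd]; ring
    rw [this] at hadd
    linarith
  rw [hdiff, one_mul]
  have hle : logSeries d (Real.log u) ≤ logSeries (fun n ↦ (1 / 2 : ℝ) ^ n) (Real.log u) :=
    logSeries_le_logSeries zero_le_one hdabs zero_le_one hhalf hdle hL
  rw [logSeries_pow] at hle
  have hsqrt : Real.exp (1 / 2 * Real.log u) = u ^ (1 / 2 : ℝ) := by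
    rw [Real.rpow_def_of_pos hu0, mul_comm]
  rw [hsqrt] at hle
  calc logSeries d (Real.log u) * u⁻¹ ≤ u ^ (1 / 2 : ℝ) * u⁻¹ :=
        mul_le_mul_of_nonneg_right hle (inv_nonneg.mpr hu0.le)
    _ = u ^ (-(1 / 2 : ℝ)) := by
        rw [← Real.rpow_neg_one, ← Real.rpow_add hu0]; norm_num

/-- `poleDensity` is measurable. [folklore] -/
theorem measurable_poleDensity : Measurable DMV.poleDensity :=
  (measurable_const.sub (measurable_const.div measurable_id)).div Real.measurable_log

/-! ### `Li` as a log-power series (BDR (2.1)) and the Chebyshev bound -/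

/-- The series `logSeries LiCoeff (log y)` has derivative `(1 − y⁻¹)/log y` at `y > 1`.
[cite: BrouckeDebruyneRevesz2023, §2 (2.1)] -/
theorem hasDerivAt_logSeries_LiCoeff_log {x : ℝ} (hx : 1 < x) :
    HasDerivAt (fun y ↦ logSeries LiCoeff (Real.log y)) ((1 - x⁻¹) / Real.log x) x := by
  have h := hasDerivAt_logSeries_log (c := LiCoeff) zero_le_one abs_LiCoeff_le (ne_of_gt (lt_trans one_pos hx))
  convert h using 1
  rw [← poleDensity_eq_logSeries hx, DMV.poleDensity, one_div]

/-- **BDR (2.1): `Li(x) = Σ_{n≥1} (log x)ⁿ/(n·n!)`** for `x ≥ 1` (both sides vanish at `1` and have the same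
derivative on `(1, ∞)`). [cite: BrouckeDebruyneRevesz2023, §2 (2.1)] -/
theorem Li_eq_logSeries {x : ℝ} (hx : 1 ≤ x) : Li x = logSeries LiCoeff (Real.log x) := by
  rcases hx.eq_or_lt with h1 | h1
  · rw [← h1, Li_one, Real.log_one, logSeries_zero]; simp [LiCoeff]
  set D : ℝ → ℝ := fun y ↦ Li y - logSeries LiCoeff (Real.log y) with hD
  have hcont : ContinuousOn D (Icc 1 x) := by
    refine (continuousOn_Li x).sub ?_
    refine (continuous_logSeries zero_le_one abs_LiCoeff_le).comp_continuousOn ?_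
    exact Real.continuousOn_log.mono fun y hy ↦ ne_of_gt (lt_of_lt_of_le one_pos hy.1)
  have hderiv : ∀ y ∈ Ioo 1 x, HasDerivAt D ((fun _ ↦ (0 : ℝ)) y) y := by
    intro y hy
    have h1 : HasDerivAt (fun z ↦ Li z - logSeries LiCoeff (Real.log z))
        ((1 - y⁻¹) / Real.log y - (1 - y⁻¹) / Real.log y) y :=
      (hasDerivAt_Li hy.1).sub (hasDerivAt_logSeries_LiCoeff_log hy.1)
    rw [sub_self] at h1
    exact h1
  obtain ⟨c, _, hc⟩ := exists_hasDerivAt_eq_slope D (fun _ ↦ (0 : ℝ)) h1 hcont hderiv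
  have hD1 : D 1 = 0 := by simp [hD, Li_one, logSeries_zero, LiCoeff]
  have hx1 : x - 1 ≠ 0 := by linarith
  have : D x = 0 := by
    have h := hc.symm
    rw [div_eq_zero_iff, hD1, sub_zero] at h
    exact h.resolve_right hx1
  simp only [hD] at this
  linarith

/-- **`li ≤ Li`** on `[1, ∞)` ("`li(x) ≤ Σ (log x)ⁿ/(n! n) = Li(x)`"). [cite: BrouckeVindas2024, proof of Theorem 3.1] -/
theorem li_le_Li {x : ℝ} (hx : 1 ≤ x) : li x ≤ Li x := by
  rw [li_eq_of_one_le hx, Li_eq_logSeries hx]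
  exact logSeries_le_logSeries zero_le_one abs_liCoeff_le zero_le_one abs_LiCoeff_le liCoeff_le_LiCoeff
    (Real.log_nonneg hx)

/-- **BV's Chebyshev bound `Li(x) ≤ 2x/log x`** for `x > 1` (coefficientwise `1/n ≤ 2/(n+1)` and
`Σ Lⁿ/((n+1) n!) = (e^L − 1)/L`). [cite: BrouckeVindas2024, proof of Theorem 3.1] -/
theorem Li_le {x : ℝ} (hx : 1 < x) : Li x ≤ 2 * x / Real.log x := by
  have hx0 : 0 < x := lt_trans one_pos hx
  have hL : 0 < Real.log x := Real.log_pos hx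
  rw [Li_eq_logSeries hx.le]
  set e : ℕ → ℝ := fun n ↦ 2 * ((1 : ℝ) ^ (n + 1) / (n + 1)) with he
  have heabs : ∀ n, |e n| ≤ 2 * 1 ^ n := fun n ↦ by
    simp only [he, one_pow, mul_div_assoc', abs_div]
    rw [abs_of_nonneg (by norm_num : (0:ℝ) ≤ 2 * 1), abs_of_pos (by positivity)]
    exact div_le_self (by norm_num) (by linarith [(Nat.cast_nonneg n : (0:ℝ) ≤ n)])
  have hcoef : ∀ n, LiCoeff n ≤ e n := by
    intro n
    simp only [LiCoeff, he, one_pow]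
    split_ifs with h
    · positivity
    · have hn : (1 : ℝ) ≤ n := by exact_mod_cast Nat.one_le_iff_ne_zero.mpr h
      rw [div_le_iff₀ (by positivity), mul_div_assoc', div_mul_eq_mul_div, le_div_iff₀ (by positivity)]
      nlinarith
  have hle := logSeries_le_logSeries zero_le_one abs_LiCoeff_le (by norm_num : (0:ℝ) ≤ 2) heabs hcoef hL.le
  have hval : logSeries e (Real.log x) = 2 * ((x - 1) / Real.log x) := by
    simp only [he]
    rw [logSeries_const_mul]
    congr 1
    have h := mul_logSeries_pow_succ_div 1 (Real.log x)
    rw [one_mul, Real.exp_log hx0] at h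
    field_simp
    linarith
  rw [hval] at hle
  refine hle.trans ?_
  rw [mul_div_assoc]
  exact mul_le_mul_of_nonneg_left (div_le_div_of_nonneg_right (by linarith) hL.le) (by norm_num)

/-- `Li(y) ≤ y − 1` for `y ≥ 1` (the integrand is at most `1`). [folklore] -/
theorem Li_le_sub_one {y : ℝ} (hy : 1 ≤ y) : Li y ≤ y - 1 := by
  have h := Li_sub_Li le_rfl hy
  rw [Li_one, sub_zero] at h
  rw [h]
  have := intervalIntegral.integral_mono_on hy (intervalIntegrable_Li_integrand hy) intervalIntegrable_const
    (fun u hu ↦ show (1 - u⁻¹) / Real.log u ≤ (1 : ℝ) from by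
      rcases hu.1.eq_or_lt with h1 | h1
      · rw [← h1]; simp
      · exact Li_integrand_le_one h1)
  simpa using this

/-! ### `Σ_{k≥1} li(x^{1/k})/k = Li(x)` -/

/-- `li(x^{1/(k+1)}) = logSeries liCoeff (log x/(k+1))` for `x ≥ 1`. [cite: BrouckeVindas2024, proof of Theorem 3.1] -/
theorem li_rpow_eq {x : ℝ} (hx : 1 ≤ x) (k : ℕ) :
    li (x ^ (1 / ((k : ℝ) + 1))) = logSeries liCoeff (Real.log x / (k + 1)) := by
  have hx0 : 0 < x := lt_of_lt_of_le one_pos hx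
  have hk : (0 : ℝ) < k + 1 := by positivity
  have h1 : 1 ≤ x ^ (1 / ((k : ℝ) + 1)) := Real.one_le_rpow hx (by positivity)
  rw [li_eq_of_one_le h1, Real.log_rpow hx0]
  congr 1
  field_simp

/-- **The defining property of `li`: `Σ_{k≥1} li(x^{1/k})/k = Li(x)`** for `x ≥ 1` (BV: "`li` is such that
`Li(x) = Σ_{ν≥1} li(x^{1/ν})/ν`"), by rearranging the non-negative double series
`Σ_k Σ_n liCoeff n (log x)ⁿ (k+1)^{−(n+1)}/n! = Σ_n liCoeff n ζ(n+1) (log x)ⁿ/n! = Σ_n LiCoeff n (log x)ⁿ/n!`.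
[cite: BrouckeVindas2024, proof of Theorem 3.1] -/
theorem hasSum_li_rpow_div {x : ℝ} (hx : 1 ≤ x) :
    HasSum (fun k : ℕ ↦ li (x ^ (1 / ((k : ℝ) + 1))) / (k + 1)) (Li x) := by
  have hL : 0 ≤ Real.log x := Real.log_nonneg hx
  -- the double family `G n k = liCoeff n Lⁿ/n! · (k+1)^{−(n+1)}`, `L = log x`
  set G : ℕ → ℕ → ℝ := fun n k ↦ liCoeff n * Real.log x ^ n / n ! * (1 / ((k + 1 : ℕ) : ℝ) ^ (n + 1)) with hG
  have hG0 : ∀ n k, 0 ≤ G n k := fun n k ↦ by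
    have := liCoeff_nonneg n; simp only [hG]; positivity
  -- inner sums over `k`: `Σ_k G n k = LiCoeff n Lⁿ/n!`
  have hinner : ∀ n, HasSum (fun k ↦ G n k) (LiCoeff n * Real.log x ^ n / n !) := by
    intro n
    rcases Nat.eq_zero_or_pos n with rfl | hn
    · have h0 : (fun k ↦ G 0 k) = fun _ ↦ 0 := by funext k; simp [hG, liCoeff]
      rw [h0]; simp [LiCoeff, hasSum_zero]
    · have hs := summable_one_div_succ_pow (by omega : 2 ≤ n + 1)
      have h := (hs.hasSum).mul_left (liCoeff n * Real.log x ^ n / n !)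
      have hval : liCoeff n * Real.log x ^ n / n ! * zetaN (n + 1) = LiCoeff n * Real.log x ^ n / n ! := by
        rw [← liCoeff_mul_zetaN n]; ring
      rw [zetaN] at hval
      rw [← hval]
      exact h
  -- summability of the double family via the `(n, k)` order
  have hsumm_n : Summable fun n ↦ LiCoeff n * Real.log x ^ n / n ! :=
    summable_logSeries zero_le_one abs_LiCoeff_le (Real.log x)
  have hF : Summable (Function.uncurry G) := by
    refine (summable_prod_of_nonneg fun p ↦ hG0 p.1 p.2).mpr ⟨fun n ↦ (hinner n).summable, ?_⟩
    exact hsumm_n.congr fun n ↦ ((hinner n).tsum_eq).symm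
  have hFval : HasSum (Function.uncurry G) (Li x) := by
    have h1 : ∑' p, Function.uncurry G p = ∑' n, ∑' k, G n k := hF.tsum_prod' fun n ↦ (hinner n).summable
    have h2 : ∑' n, ∑' k, G n k = logSeries LiCoeff (Real.log x) := by
      rw [logSeries]; exact tsum_congr fun n ↦ (hinner n).tsum_eq
    rw [Li_eq_logSeries hx, ← h2, ← h1]
    exact hF.hasSum
  -- swap the order of summation and identify the fibres over `k`
  have hswap : HasSum ((Function.uncurry G) ∘ (Equiv.prodComm ℕ ℕ)) (Li x) :=
    (Equiv.prodComm ℕ ℕ).hasSum_iff.mpr hFval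
  refine hswap.prod_fiberwise fun k ↦ ?_
  have hk : (0 : ℝ) < (k : ℝ) + 1 := by positivity
  have h := (hasSum_logSeries zero_le_one abs_liCoeff_le (Real.log x / (k + 1))).div_const ((k : ℝ) + 1)
  rw [← li_rpow_eq hx k] at h
  have hfun : ∀ n, (Function.uncurry G ∘ (Equiv.prodComm ℕ ℕ)) (k, n) =
      liCoeff n * (Real.log x / (k + 1)) ^ n / n ! / (k + 1) := by
    intro n
    simp only [Function.comp_apply, Equiv.prodComm_apply, Prod.swap_prod_mk, Function.uncurry_apply_pair, hG]
    push_cast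
    rw [div_pow]
    field_simp
    ring
  simp_rw [hfun]
  exact h

end Literature.NumberTheory.BeurlingPrimes
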